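import Summits.BirchSwinnertonDyer.BirchSwinnertonDyer.Theses.UniversalToricDescent
import Summits.BirchSwinnertonDyer.BirchSwinnertonDyer.Theorems.UniversalToricDescentStrictPlaceGrowthReduction
import Summits.BirchSwinnertonDyer.BirchSwinnertonDyer.Theorems.UniversalToricDescentStrictPlaceLocalCount
import Summits.BirchSwinnertonDyer.BirchSwinnertonDyer.Theorems.UniversalToricDescentDefectTransportTwinBaseFiniteOnly
import Summits.BirchSwinnertonDyer.BirchSwinnertonDyer.Theorems.AdditiveKolyvaginRoadLevelKolyvaginSystemsAdditiveSplitCompletion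
import Literature.NumberTheory.IwasawaTheory.Greenberg2006.LocalEulerPoincareCorank
import HarnessLib

/-!
# STUB TS1′ `stub_twinStrictSurj` of crux ♭T≤ `DefectTransportModThreePT` (stmt-BirchSwinnertonDyer-23042, line `sigmacongruence`):
# Greenberg–Vatsal Prop. 2.1 at the strict place `𝔭′` for the rank-free twin — PROVED by the growth road

Route `UniversalToricDescent`, lead prover `bsd-wall-utd-p1` g15–g17. THEOREMS ONLY (no definition, no named fact, no `sorry`);
STUB MODE `--supports stmt-BirchSwinnertonDyer-23042`. BSD is not proved by any of this.

Assembly (every input a tree theorem): the growth-road reduction `exists_mem_selmerAc_forall_resKerD_eq_of_localCount` (p669209)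
fed with (i) Poitou–Tate over the layers (the route's `PoitouTateSelmerStructureDualityFact` by name), (ii) `E′(K_∞)[3^∞] = 0` from the
stub's hypothesis «no `ker κ`-fixed `3`-torsion», (iii) the exact index of `D_𝔭′` (`…SigmaLocalStabilizer.exists_pow_and_forall_dvd_of_not_le`,
`𝔭′` finitely decomposed in the anticyclotomic tower), (iv) the LOCAL TWO-SIDED COUNT `strictPlace_localCount` (p673330) at the
degree-one place `𝔭′` (`#(𝓞_{𝔭′}/3) = 3` from `3` split in the imaginary quadratic `K`; local tower torsion finiteness for the
non-additive twin, `localTowerTorsionFiniteAt_baseChange_three_of_not_addv`), with `[K:ℚ] = 2`.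

References: [GreenbergVatsal2000] §2 Prop. (2.1) (pp. 23–24); [GreenbergLNM1716] §1 p. 60, §3 Lemma 3.1–3.3, §4 Prop. 4.13–4.15;
[Washington1997] §13.2; [MilneADT2006] I Thm. 2.8, 4.10.
-/

noncomputable section

open scoped Classical

set_option linter.dupNamespace false
set_option autoImplicit false

namespace Summit.BirchSwinnertonDyer.BirchSwinnertonDyer.Cruxes.DefectTransportModThreePT.SigmaCongruence

open PowerSeries WeierstrassCurve NumberField IsDedekindDomain Field Polynomial
  Literature.NumberTheory.EllipticCurves
  Literature.NumberTheory.EllipticCurves.ModularForms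
  Literature.NumberTheory.EllipticCurves.Rank1Residual
  Literature.NumberTheory.EllipticCurves.GreenbergSelmer
  Literature.NumberTheory.EllipticCurves.IwasawaAlgebra
  Literature.NumberTheory.GaloisRepresentations Literature.NumberTheory.GaloisCohomology
  Summit.BirchSwinnertonDyer.Rank1Residual Summit.BirchSwinnertonDyer.Rank1Residual.X11b
  Summit.BirchSwinnertonDyer.Rank1Residual.X11b.AcSelmer Summit.BirchSwinnertonDyer.Rank1Residual.X11b.Coinv
  Summit.BirchSwinnertonDyer.Rank1Residual.Iwasawa
  Summit.BirchSwinnertonDyer.BirchSwinnertonDyer.Theorems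

/-- **STUB TS1′ ((S′), Greenberg–Vatsal Prop. 2.1 at the strict place for the twin, rank-free) — PROVED.** Every right-`ker κ`-invariant
left-`D_{𝔭′}`-equivariant `F : Γ_K → H¹(kerD κ 𝔭′, E′_K[3^∞])` is the `𝔭′`-signature of some `s ∈ Sel^{S}_{v₀}(K_∞, E′[3^∞])`. Growth road:
weak-Leopoldt growth of the relaxed dual versus the local two-sided count at `𝔭′` over `Λ_c`, torsion-freeness of the local dual, and
«growth ⟹ injectivity of the transpose ⟹ surjectivity». [cite: GreenbergVatsal2000, §2 Prop. (2.1) (pp. 23–24)]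
[cite: GreenbergLNM1716, §4 Prop. 4.13–4.15 (pp. 122–126)] -/
theorem stub_twinStrictSurj :
    Summit.BirchSwinnertonDyer.BirchSwinnertonDyer.Theses.UniversalToricDescent.PoitouTateSelmerStructureDualityFact →
    Summit.BirchSwinnertonDyer.BirchSwinnertonDyer.Theses.UniversalToricDescent.PoitouTateShaTateDualFact →
    ∀ (W' : WeierstrassCurve ℚ) [W'.IsElliptic] [W'.IsGloballyMinimal] (K : Type) [Field K] [NumberField K],
      ¬ Addv W' 3 → IsImaginaryQuadratic K → SplitsIn K 3 →
      ∀ (κ : ZpExtension K 3), κ.IsAnticyclotomic → ∀ (γ : absoluteGaloisGroup K) [Fact (κ.IsTopGenerator γ)]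
      (𝔭 𝔭' : HeightOneSpectrum (𝓞 K)), ((3 : ℕ) : 𝓞 K) ∈ 𝔭.asIdeal → ((3 : ℕ) : 𝓞 K) ∈ 𝔭'.asIdeal → 𝔭 ≠ 𝔭' →
      (∀ m : (W'.baseChange K).geomPrimaryTorsion 3, (∀ σ ∈ κ.kerSubgroup, σ • m = m) → 3 • m = 0 → m = 0) →
      ∀ (S : Set (HeightOneSpectrum (𝓞 K))), S.Finite →
      (∀ v ∈ S, ((3 : ℕ) : 𝓞 K) ∉ v.asIdeal ∧ ¬ (decomp v ≤ κ.kerSubgroup)) →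
      Set.Finite {s : selmerAc (W'.baseChange K) 3 κ 𝔭' S | 3 • s = 0} →
      ∀ (v₀ : HeightOneSpectrum (𝓞 K)), ((3 : ℕ) : 𝓞 K) ∉ v₀.asIdeal → v₀ ∉ S →
      ∀ (F : absoluteGaloisGroup K → subgroupH1 (kerD κ 𝔭') ((W'.baseChange K).geomPrimaryTorsion 3)),
      (∀ (σ h : absoluteGaloisGroup K), h ∈ κ.kerSubgroup → F (σ * h) = F σ) →
      (∀ (d : decomp (K := K) 𝔭') (σ : absoluteGaloisGroup K), F ((d : absoluteGaloisGroup K) * σ) =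
        conjH1 (kerD κ 𝔭') ((W'.baseChange K).geomPrimaryTorsion 3) d (F σ)) →
      ∃ s ∈ selmerAc (W'.baseChange K) 3 κ v₀ S, ∀ σ : absoluteGaloisGroup K,
        resKerD κ ((W'.baseChange K).geomPrimaryTorsion 3) 𝔭' ((W'.baseChange K).conjH1 3 κ.kerSubgroup σ s) = F σ := by
  intro hPT _hPT2 W' _ _ K _ _ hadd hK hsplit κ hκ γ _ 𝔭 𝔭' _h𝔭 h𝔭' _hne hG S hS _hSnice hfinS v₀ hv₀ _hv₀S F hFH hFD
  haveI : Fact (Nat.Prime 3) := ⟨Nat.prime_three⟩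
  haveI : IsTotallyComplex K := hK.2
  -- (ii) `E′(K_∞)[3^∞] = 0`
  have hB : FixedPoints.addSubgroup κ.kerSubgroup ((W'.baseChange K).geomPrimaryTorsion 3) = ⊥ := by
    have key : ∀ (k : ℕ) (m : (W'.baseChange K).geomPrimaryTorsion 3), (∀ σ ∈ κ.kerSubgroup, σ • m = m) →
        3 ^ k • m = 0 → m = 0 := by
      intro k
      induction k with
      | zero =>
        intro m _ h
        rwa [pow_zero, one_smul] at h
      | succ k ih =>
        intro m hm h
        refine ih m hm (hG (3 ^ k • m) (fun σ hσ ↦ by rw [smul_comm σ (3 ^ k) m, hm σ hσ]) ?_)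
        rw [← mul_smul, ← pow_succ', h]
    rw [eq_bot_iff]
    intro m hm
    rw [AddSubgroup.mem_bot]
    obtain ⟨k, hk⟩ := m.2
    exact key k m (fun σ hσ ↦ hm ⟨σ, hσ⟩) (Subtype.ext (by rw [AddSubgroupClass.coe_nsmul]; exact hk))
  -- (iii) the exact index of `D_𝔭′`
  have h𝔭'dec : ¬ (decomp 𝔭' ≤ κ.kerSubgroup) :=
    ZpExtension.decomp_not_le_kerSubgroup_above_of_isAnticyclotomic_holds K 3 hK (by decide) κ hκ 𝔭' h𝔭'
  obtain ⟨c, ⟨d₁, hd₁⟩, hc, hdvd⟩ :=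
    UniversalToricDescentSigmaLocalStabilizer.exists_pow_and_forall_dvd_of_not_le κ 𝔭' h𝔭'dec
  -- (iv) the degree-one count `#(𝓞_{𝔭′}/3) = 3` and the local tower torsion finiteness for the twin
  have hef := AdditiveKoly.SplitCompletion.ramificationIdx_mul_inertiaDeg_eq_one_int (K := K) (p := 3) hK.1 hsplit 𝔭' h𝔭'
  have hO : Nat.card (𝔭'.adicCompletionIntegers K ⧸ Ideal.span {((3 : ℕ) : 𝔭'.adicCompletionIntegers K)}) = 3 := by
    have h := Literature.NumberTheory.IwasawaTheory.Greenberg2006.natCard_adicCompletionIntegers_quotient_natCast_of_mem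
      K 𝔭' 3 h𝔭'
    rwa [hef, pow_one] at h
  have hfinT := UniversalToricDescentDefectTransport.localTowerTorsionFiniteAt_baseChange_three_of_not_addv W' hadd hK
    hsplit κ hκ 𝔭' h𝔭'
  obtain ⟨b, hb⟩ := UniversalToricDescentStrictPlaceLocalCount.strictPlace_localCount (W'.baseChange K) 3 κ 𝔭' hO hfinT
    hd₁ hc hdvd
  -- the growth road
  exact UniversalToricDescentStrictPlaceGrowth.exists_mem_selmerAc_forall_resKerD_eq_of_localCount (W'.baseChange K) 3 κ
    (fun n ↦ hPT (κ.layer n)) hB (Fact.out : κ.IsTopGenerator γ) hS hv₀ hfinS hd₁ hc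
    (fun n k ↦ (hb n k).1) (fun n k ↦ by rw [hK.1]; exact (hb n k).2.1) (fun n k ↦ by rw [hK.1]; exact (hb n k).2.2)
    F hFH hFD

end Summit.BirchSwinnertonDyer.BirchSwinnertonDyer.Cruxes.DefectTransportModThreePT.SigmaCongruence

end
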